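import HarnessLib
import Summits.QuantumFields.YangMills.Theses.MirrorModularBoosts
import Summits.QuantumFields.YangMills.Theorems.HypercubicLimit.Negative.AllTimesGapFalse
import Summits.QuantumFields.YangMills.Theorems.HypercubicLimit.Negative.NonTrivialityBridge
import Summits.QuantumFields.YangMills.Theorems.HypercubicLimit.Negative.NonabelianLoadBearing
import Summits.QuantumFields.YangMills.Theorems.HypercubicLimit.Negative.SummitTie
import Summits.QuantumFields.YangMills.Theorems.PencilRigidityHypercubicLimitDefs
import Summits.QuantumFields.YangMills.Theorems.PencilRigidityHypercubicLimitDefsB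
import Summits.QuantumFields.YangMills.Theorems.PencilRigidityHypercubicLimitCondMeanLocality
import Summits.QuantumFields.YangMills.Theorems.PencilRigidityHypercubicLimitTelescoping
import Summits.QuantumFields.YangMills.Theorems.PencilRigidityHypercubicLimitLatticeGapBridge
import Summits.QuantumFields.YangMills.Theorems.PencilRigidityHypercubicLimitUniformBound
import Summits.QuantumFields.YangMills.Theorems.PencilRigidityHypercubicLimitSoftLegsU
import Summits.QuantumFields.YangMills.Theorems.MirrorModularBoostsHypercubicLimitPeelReflectionLegs
import Summits.QuantumFields.YangMills.Theorems.PencilRigidityWeakCouplingHypercubicLimitOfRpCore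

/-!
# Line `conditional-mean-telescoping`, crux `HypercubicLimit` (stmt-QuantumFields-8646) — companion to the reshape-4 skeleton:
# the ALTERNATIVE UV socket via the twin's peel line (c5 seat, kernel-checked, sorry-free)

Item 8646 is implied by its weak-coupling re-type 16154 (`Negative/SummitTie`, monotone: drop `sch.HasWeakCouplingLimit`), and the
twin crux 16154 is closed by the peel line modulo (F′) the blanket product bound, (WI₂) `CornerFreeInfluence`, (W2), (NG), (L′)
(`PeelAndDisseminate.hypercubicLimit_of_physicsInputs`, p144898; `CoincidenceRotationBootstrap.HypercubicLimit` is verbatim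
`MirrorModularBoosts.WeakCouplingHypercubicLimit`).  Hence the UV residual of item 8646 is the MINIMUM of the two UV bets
{(WI₂) ∧ (WIₙ) `InfluenceReverseHolder`} (registered skeleton `Lines/conditional_mean_telescoping.lean` §7) and {(WI₂) ∧ (F′)} (peel),
over the shared IR sockets (L′), (W2), (NG).  No stub is registered for (F′) on this crux: it is the twin's registered
`stub_blanketProductBound`.  A THIRD residual form, `hypercubicLimit_via_rpCore`, records the single core hypothesis of the twin
cruxes' coupling-response / trace-norm lines (`hypercubicLimit_of_rpCore`, p144204): weak-coupling scheme with polynomial volume and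
renormalisation + `UniformFunctionalBoundPlanes` (UV) + `RPSpectral` (IR) + a `κ₃` floor.
-/

noncomputable section

open scoped SchwartzMap ENNReal
open MeasureTheory Filter Topology
open Literature.MathematicalPhysics.AQFT Literature.MathematicalPhysics.QuantumLattice
open Literature.MathematicalPhysics.QuantumFieldTheory
open Literature.Probability.LatticeModels (box Site)
open Summit.QuantumFields.YangMills.Theorems.HypercubicLimit.Negative
  (torusPlaquette torusDensity rpSquare influence exterior)

namespace Summit.QuantumFields.YangMills.Cruxes.HypercubicLimit.ConditionalMeanTelescoping

/-- **The crux from the PEEL line's physics inputs** (alternative to §7: (WIₙ) replaced by (F′)); sorry-free, consumes no stub of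
this skeleton. -/
theorem hypercubicLimit_via_peelInputs
    (hF : (∀ (G : Type) [Group G] [TopologicalSpace G] [IsTopologicalGroup G] [CompactSpace G]
      [MeasurableSpace G] [BorelSpace G], IsCompactSimpleLieGroup G →
      ∀ (r : LatticeRep G) (β₁ C₁ c₂ : ℝ) (m : ℝ → ℝ), GapData G r β₁ C₁ c₂ m →
        ∀ c₀ : ℝ, 0 < c₀ → ∃ (lam : ℕ) (C β₀ : ℝ), 1 ≤ lam ∧ ∀ β : ℝ, β₀ ≤ β → ∀ n : ℕ,
          ∃ S₀ : ℕ, ∀ S : ℕ, S₀ ≤ S →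
            ∀ (R : ℕ) (o : Fin n → Fin 4 × Fin 4) (x : Fin n → Site 4),
              (∀ k, (o k).1 ≠ (o k).2) → 1 ≤ R → (R : ℝ) ≤ c₀ / m β → 4 * (lam * R) + 4 < 2 * S + 1 →
              (∀ k l, k ≠ l → ∃ μ : Fin 4, (2 * (lam * R) + 1 : ℤ) < |x k μ - x l μ| ∧ |x k μ - x l μ| ≤ S) →
                ∫ U, ∏ k, ((wilsonMeasure r.ρ β : Measure (GaugeConfig 4 (2 * S + 1) G))[fun U =>
                    |((wilsonMeasure r.ρ β : Measure (GaugeConfig 4 (2 * S + 1) G))[fun U =>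
                        torusPlaquette r (2 * S + 1) (o k).1 (o k).2 (x k) U -
                          ∫ V, torusPlaquette r (2 * S + 1) (o k).1 (o k).2 (x k) V
                            ∂(wilsonMeasure r.ρ β : Measure (GaugeConfig 4 (2 * S + 1) G)) |
                      (exterior (2 * S + 1) R (x k) : MeasurableSpace (GaugeConfig 4 (2 * S + 1) G))]) U| |
                    (exterior (2 * S + 1) (lam * R) (x k) : MeasurableSpace (GaugeConfig 4 (2 * S + 1) G))]) U
                  ∂(wilsonMeasure r.ρ β : Measure (GaugeConfig 4 (2 * S + 1) G)) ≤
                ∏ k, C * influence r β S R (x k) (o k).1 (o k).2 2))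
    (hWI : CornerFreeInfluence) (hW2 : WindowRegularity) (hNG : NonGaussianFloor) (hL : LatticeGapInput) :
    Summit.QuantumFields.YangMills.Theses.MirrorModularBoosts.HypercubicLimit := by
  -- 16154 ⇒ 8646: the re-type is monotone (positive form of `Negative/SummitTie`'s
  -- `not_weakCouplingHypercubicLimit_of_not_hypercubicLimit`), and `CoincidenceRotationBootstrap.HypercubicLimit`
  -- (the conclusion of the twin's `hypercubicLimit_of_physicsInputs`) is verbatim `MirrorModularBoosts.WeakCouplingHypercubicLimit`.
  have hW : Summit.QuantumFields.YangMills.Theses.MirrorModularBoosts.WeakCouplingHypercubicLimit := by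
    intro G _ _ _ _ hG
    exact Summit.QuantumFields.YangMills.Cruxes.HypercubicLimit.PeelAndDisseminate.hypercubicLimit_of_physicsInputs
      hF hWI hW2 hNG hL G hG
  by_contra h'
  exact Summit.QuantumFields.YangMills.Theorems.HypercubicLimit.Negative.not_weakCouplingHypercubicLimit_of_not_hypercubicLimit
    h' hW


/-- **The crux from the twin line's RP CORE** (third residual form, c5 seat; sorry-free, consumes no stub of this crux): the single
core hypothesis of the coupling-response / trace-norm-cold-pressure lines of the twin cruxes 16120/16154
(`TraceNormColdPressure.hypercubicLimit_of_rpCore`, p144204) — for every compact simple `G` a scheme AT WEAK COUPLING with polynomial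
volume and renormalisation, the `k`-uniform E0′-type bound on all plane-string distributions (`UniformFunctionalBoundPlanes`, UV),
the RP-spectral relative clustering `RPSpectral r sch Δ C` (IR) and a time-separated `κ₃` floor — implies item 8646 through 16154
and the monotone re-type. -/
theorem hypercubicLimit_via_rpCore
    (hcore : (∀ (G : Type) [Group G] [TopologicalSpace G] [IsTopologicalGroup G] [CompactSpace G] [MeasurableSpace G] [BorelSpace G], IsCompactSimpleLieGroup G → ∃ (r : LatticeRep G) (sch : SpeciesScheme (YMSpecies G)), sch.HasWeakCouplingLimit ∧ Summit.QuantumFields.YangMills.Cruxes.HypercubicLimit.CouplingResponse.PolyVolume sch ∧ Summit.QuantumFields.YangMills.Cruxes.HypercubicLimit.CouplingResponse.PolyRenorm r sch ∧ Summit.QuantumFields.YangMills.Cruxes.HypercubicLimit.CouplingResponse.UniformFunctionalBoundPlanes r sch ∧ (∃ Δ C : ℝ, 0 < Δ ∧ Summit.QuantumFields.YangMills.Cruxes.HypercubicLimit.CouplingResponse.RPSpectral r sch Δ C) ∧ (∃ (f g h : 𝓢(EuclideanSpace ℝ (Fin 4), ℝ)) (δ : ℝ), tsupport f ⊆ {y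 : EuclideanSpace ℝ (Fin 4) | y 0 < 0} ∧ tsupport g ⊆ {y : EuclideanSpace ℝ (Fin 4) | 0 < y 0} ∧ tsupport h ⊆ {y : EuclideanSpace ℝ (Fin 4) | 0 < y 0} ∧ Disjoint (tsupport g) (tsupport h) ∧ 0 < δ ∧ ∀ᶠ k in atTop, δ ≤ |latticeSchwinger r.ρ sch (fun s => s.F) k 3 (fun _ => r.curvature) ![f, g, h] - latticeSchwinger r.ρ sch (fun s => s.F) k 1 (fun _ => r.curvature) ![f] * latticeSchwinger r.ρ sch (fun s => s.F) k 2 (fun _ => r.curvature) ![g, h] - latticeSchwinger r.ρ sch (fun s => s.F) k 1 (fun _ => r.curvature) ![g] * latticeSchwinger r.ρ sch (fun s => s.F) k 2 (fun _ => r.curvature) ![f, h] - latticeSchwinger r.ρ sch (fun s => s.F) k 1 (fun _ => r.curvature) ![h] * latticeSchwinger r.ρ sch (fun s => s.F) k 2 (fun _ => r.curvature) ![f, g] + 2 * (latticeSchwinger r.ρ sch (fun s => s.F) k 1 (fun _ => r.curvature) ![f] * latticeSchwinger r.ρ sch (fun s => s.F) k 1 (fun _ => r.curvature) ![g] * latticeSchwinger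 r.ρ sch (fun s => s.F) k 1 (fun _ => r.curvature) ![h])|))) :
    Summit.QuantumFields.YangMills.Theses.MirrorModularBoosts.HypercubicLimit := by
  have hW : Summit.QuantumFields.YangMills.Theses.MirrorModularBoosts.WeakCouplingHypercubicLimit := by
    intro G _ _ _ _ hG
    exact Summit.QuantumFields.YangMills.Theorems.WeakCouplingHypercubicLimit.TraceNormColdPressure.hypercubicLimit_of_rpCore
      hcore G hG
  by_contra h'
  exact Summit.QuantumFields.YangMills.Theorems.HypercubicLimit.Negative.not_weakCouplingHypercubicLimit_of_not_hypercubicLimit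
    h' hW

end Summit.QuantumFields.YangMills.Cruxes.HypercubicLimit.ConditionalMeanTelescoping

end
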